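import Mathlib
import Literature.MathematicalPhysics.QuantumLattice.GrassmannWickOrderedRGE
import Literature.MathematicalPhysics.QuantumLattice.FermiRG.Salmhofer1998Sec2
import HarnessLib

/-!
# Salmhofer, *Continuous renormalization for fermions and Fermi liquid theory* (CMP 194 (1998) 249):
# Proposition 2 — the determinant formula for the Wick coefficients `Q_{m,r}` of the bilinear term
# (Appendix B "Wick reordering"; §4.1 (4.2)–(4.3))

Companion to the typer files F7b `Salmhofer1998Sec2.lean` (§3–4: `kappaSum`, `MIndex`, `covMatrix`, `antisym`,
`quadTerm` = (4.3)) and F7af `GrassmannWickOrderedRGE.lean` (§3.2 (3.12)–(3.17): `wickKernel`, the flow in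
Wick-ordered coordinates) of the cell `gate-hubbard-kl` (statements-first wave D-0069 (2); DAG row `Sal98.P2`,
wave-optional licence F-078; F7af typed the LEFT side of Proposition 2 — "`Q` = the Wick coefficients of
`½(δ𝒢/δψ, Ċ δ𝒢/δψ)`" — as theorems and left the RIGHT side, the determinant evaluation of Appendix B, untyped).
Both files are DEFINITION-FROZEN and are imported, not edited.

Source: M. Salmhofer, Commun. Math. Phys. **194** (1998) 249–295, arXiv:cond-mat/9706188 [Salmhofer1998]; locators
`p.N Ln` = chunk `pNNNN.txt` line `n` of the materialised arXiv TeX (`lit read arxiv:cond-mat/9706188`; cell render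
HOME/dag/texts/paper-arxiv-cond-mat_9706188), NOT printed pages: Proposition 2 p.12 L69–106 (TeX `\Qrmtdef`); (3.16)/(3.17)
p.12 L47–63; (3.20) `𝔸_m` p.12 L108–122; §4.1 (4.2) `∂_t det` expansion p.14 L17–32 and (4.3) p.14 L44–52; Appendix B
(= §10 of the arXiv TeX, "Wick reordering") p.30 L1 – p.31 L140, Lemma 10 p.30 L83–101.

## What is typed

Finite label set `Γ` ("`𝒜` is a finite-dimensional Grassmann algebra", §3), coefficients in `ℂ` (print; F7b's `kappaSum`
is `ℂ`-valued).  For a Wick-ordering covariance `D` (print: `D_t`, the covariance of the unintegrated fields) and its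
derivative `Ḋ` (print: `Ḋ_t = ∂_t D_t = -Ċ_t`, p.11 L159–161), and elements `𝒢_r` of the even subalgebra with
Wick-ordered coefficient functions `G_{m,r} = wickKernel ℂ D 𝒢_r m` ((3.12), F7af) of degree `≤ m̄(r)`:

* `detDeriv A B = Σ_l det(A with column l replaced by the l-th column of B)` — the derivative of `det` at `A` in the
  direction `B` (multilinearity in the columns; print's (4.2), p.14 L17–27: "`∂_t det 𝒟_t^{(i)}(V,W) =
  Σ_{l,l'} (-1)^{l+l'} Ḋ_t(V_l,W_{l'}) det 𝒟_t^{(i-1)}(V^{(l)},W^{(l')})`"), so that `∂_t det 𝒟_{D_t}^{(i)}(V,W) =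
  detDeriv (𝒟_D^{(i)}(V,W)) (𝒟_{Ḋ}^{(i)}(V,W))`, `𝒟^{(i)}` = F7b `covMatrix`;
* `pairKernel` — one `(m₁, m₂, i)` term of Proposition 2's right side for two coefficient families,
  `Σ_{V,W ∈ Γ^i} (∂_t det 𝒟_t^{(i)}(V,W)) G¹_{m₁}(X₁,V) G²_{m₂}(W̃,X₂)` with `X₁ = (X_1,…,X_{m₁-i})`,
  `X₂ = (X_{m₁-i+1},…,X_m)`, `W̃ = (W_i,…,W_1)` (p.12 L99–104); `wickReorderKernel` — the full `Q_{m,r}(X) = ∫dκ_{mr} …`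
  with F7b's `kappaSum` (`r₁ + r₂ = r`, `r₁, r₂ ≥ 1`, `(m₁,m₂,i) ∈ 𝓜_{r₁r₂m}`, weights `κ = C(m₁,i)C(m₂,i)`);
* the named fact **`WickReorderingFormula`** (licence F-078): the Grassmann-algebra identity (3.16)–(3.17) with the
  right side of Proposition 2 inserted,
  `Σ_{r₁+r₂=r} (δ𝒢_{r₁}/δψ, Ċ δ𝒢_{r₂}/δψ)_Γ = Σ_m Σ_{X ∈ Γ^m} Q_{m,r}(X) · Ω_D(ψ(X_1)⋯ψ(X_m))`, `Ċ = -Ḋ`,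
  under the standing antisymmetry `D(X,Y) = -D(Y,X)`, `Ḋ(X,Y) = -Ḋ(Y,X)` of fermionic covariances (Lemma 2 / (5.2);
  "the antisymmetry of `D_t`" is used in Appendix B, p.30 L76–78) — with the SIGN of each `i`-term left existential
  (`∃ σ : ℕ → {±1}`), for the reason explained under "SIGN" below; everything else (the weights `κ`, the index set
  `𝓜`, the placement `G¹(X₁,V)`, `G²(W̃,X₂)`, the determinant derivative) is as printed.

All integration weights cancel: with print's `∫_Γ dX = ε_Γ Σ_X`, `G_{m,r} = ε_Γ^{-m} · wickKernel` and
`Q_{m,r} = ε_Γ^{-m} ·` (the coefficient w.r.t. `Σ_X`), the factor `ε^{2i} ε^{-m₁} ε^{-m₂} = ε^{-m}` of the right side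
matches the left (`m₁ + m₂ = m + 2i`); the pairing `(δa/δψ, C δb/δψ)_Γ = Σ_{X,Y} ∂_X a C(X,Y) ∂_Y b` is weight-free for the
same reason (F7x `grassmannDerivPairing`, GrassmannPolchinskiEquation.lean "Design").  So the typed identity uses plain
sums throughout, exactly like F7z/F7af.

## SIGN — why the sign of the `i`-terms is existential (read this before auditing)

Proposition 2 (p.12 L72–76; = Salmhofer 1999, Prop. 4.5 (4.117)) prints the factor `(-∂_t det 𝒟_t^{(i)}(V,W))` for
every `i`.  §4.1 then "performs the derivative with respect to `t`" ((4.2), p.14 L17–27) and, after the rearrangements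
p.14 L33–41 whose signs `(-1)^{i-l}(-1)^{i-l'}(-1)^{l+l'} = +1` cancel, prints (4.3) (p.14 L44–52):
`Q_{m,r}(t|X) = ∫dκ_{mr} i² ∫dVdW Ḋ_t(V,W) ∫dYdZ det𝒟_t^{(i-1)}(Y,Z) G_{m₁r₁}(t|X₁,Y,V) G_{m₂r₂}(t|W,Z̃,X₂)` with NO
minus sign — i.e. (4.3) is Proposition 2 with `+∂_t det` for every `i` (print-internal discrepancy, already recorded in
F7b's docstring of `ManyFermionGreenFunctionBound`, "On signs").  In the TREE's conventions (F7x's left derivatives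
and pairing `(δa/δψ, C δb/δψ)_Γ = Σ ∂_X a C(X,Y) ∂_Y b`, F7z's `Ω_D = e^{-Δ_D}` with `Ω_D(ψ_Xψ_Y) = ψ_Xψ_Y + D(X,Y)` for
antisymmetric `D` — ref-2-verified to be print's `Δ_C`, `Ω` and `(·,·)_Γ`) the smallest instances decide as follows.
`i = 1`: for `𝒢¹ = Ω_D(ψ(A)ψ(B))`, `𝒢² = Ω_D(ψ(E)ψ(F))` the kernel-checked lemma `grassmannDerivPairing_wickPair`
below gives `(δ𝒢¹/δψ, C' δ𝒢²/δψ)_Γ = C'(A,E)ψ_Bψ_F - C'(A,F)ψ_Bψ_E - C'(B,E)ψ_Aψ_F + C'(B,F)ψ_Aψ_E`; with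
`ψ_Uψ_{U'} = Ω_D(ψ_Uψ_{U'}) - D(U,U')`, `C' = Ċ = -Ḋ` and `G¹(A,B) = -G¹(B,A) = ½`, `G²(E,F) = -G²(F,E) = ½`
(`wickKernel_wickOrder_genProd`) its degree-two Wick coefficients are `+κ_{221} Σ_{V,W} Ḋ(V,W) G¹(U,V) G²(W,U')`
(`κ_{221} = 4`; e.g. at `(U,U') = (B,F)`: `C'(A,E) = -Ḋ(A,E) = 4·Ḋ(A,E)·(-½)·½`) — the sign of (4.3), NOT of the
display of Proposition 2.  `i = 2`: the degree-zero Wick coefficient of the same pairing is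
`-[C'(A,E)D(B,F) - C'(A,F)D(B,E) - C'(B,E)D(A,F) + C'(B,F)D(A,E)] = Ḋ(A,E)D(B,F) - Ḋ(A,F)D(B,E) - Ḋ(B,E)D(A,F) + Ḋ(B,F)D(A,E)`,
while `κ_{222} Σ_{V,W} ∂_t det𝒟^{(2)}(V,W) G¹(V₁,V₂) G²(W₂,W₁)` evaluates (four label assignments, by hand, recorded in
the cell's notes) to the NEGATIVE of that — the sign of Proposition 2, NOT of (4.3).  So neither printed orientation holds
for all `i` in these conventions; the cell's own re-derivation of Appendix B (Wick product rule with contraction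
`-D` per `D`-line, the `C'`-line from the two derivatives, `W̃` absorbing `(-1)^{(i-1)(i-2)/2}`) gives the factor
`(-1)^{i-1} ∂_t det 𝒟_t^{(i)}`, consistent with both instances.  Rather than mint either printed sign (one of which is
refuted at `i = 1` by a kernel-checked computation) or the cell's unreviewed `(-1)^{i-1}`, **the named fact asserts the
identity with SOME sign `σ(i) ∈ {+1,-1}` per `i`-term** — strictly weaker than each of the three readings, identical
to them for every norm statement (`|σ ∂_t det| = |∂_t det|`; §4–6 and F7b's `quadTerm` only use absolute values), and
the structure (`κ`, `𝓜`, `X₁/V`, `W̃/X₂`, the determinant derivative) exactly as printed.  The cell's determination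
`σ(i) = (-1)^{i-1}` is recorded as `wickReorderSign` (a definition, asserted nowhere).  This paragraph is the
mis-statement record for row `Sal98.P2`.

## Not proved here

The identity itself (Appendix B: the source trick (B.4)–(B.7), Lemma 10 "left to the reader", the contraction-pattern
sum (B.9)–(B.15)) — an `L`-sized finite Grassmann computation on the doubled algebra `𝒜((S₁ ⊕ S₂) ⊕ Γ)` with F7z's
machinery; it stays a named fact (licence F-078).  The equivalence of the Proposition-2 shape with the (4.3) shape
(Laplace expansion (4.2) + antisymmetry of the `G`'s) is likewise not proved.  No `instance`, no `notation`; nothing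
about the Hubbard model is asserted or denied; no sorry/axiom.
-/

noncomputable section

namespace Literature.MathematicalPhysics.QuantumLattice.FermiRG

namespace Salmhofer1998

open GrassmannAlgebra Finset

/-! ### The right side of Proposition 2 -/

/-- The derivative of the determinant at `A` in the direction `B`: `Σ_l det(A[column l ← column l of B])`
(multilinearity of `det` in the columns; expanding each replaced column gives print's (4.2),
`Σ_{l,l'} (-1)^{l+l'} B_{l l'} det A^{(l,l')}`, p.14 L17–27).  With `A = 𝒟_{D_t}^{(i)}(V,W)` and `B = 𝒟_{Ḋ_t}^{(i)}(V,W)`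
this is `∂_t det 𝒟_t^{(i)}(V,W)`. `Sal98.P2` · Salmhofer 1998 (4.2) · p.14 L17–27.
[cite: Salmhofer1998, §4.1 (4.2) (p.14 L17–27)] -/
def detDeriv {i : ℕ} (A B : Matrix (Fin i) (Fin i) ℂ) : ℂ :=
  ∑ l : Fin i, (A.updateCol l fun k => B k l).det

/-- **One term of the right side of Proposition 2** for two coefficient families `G¹, G²` and `(m₁, m₂, i)` with
`m₁ + m₂ = m + 2i`, `i ≤ m₁, m₂` (else `0`):
`Σ_{V ∈ Γ^i} Σ_{W ∈ Γ^i} (∂_t det 𝒟_t^{(i)}(V,W)) · G¹_{m₁}(X₁, V) · G²_{m₂}(W̃, X₂)`, `X₁ = (X_1,…,X_{m₁-i})`,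
`X₂ = (X_{m₁-i+1},…,X_m)`, `V = (V_1,…,V_i)`, `W̃ = (W_i,…,W_1)`, `(𝒟^{(i)}(V,W))_{kl} = D(V_k,W_l)` (p.12 L99–106; F7b
`covMatrix`), with the UNSIGNED `∂_t det` (the sign of the `i`-term is carried by `wickReorderKernel`, module docstring
"SIGN").  Plain sums (weights cancel, module docstring). `Sal98.P2` · Salmhofer 1998 Proposition 2 · p.12 L69–106.
[cite: Salmhofer1998, Proposition 2 (p.12 L69–106) with (4.2)–(4.3) (p.14 L17–52)] -/
def pairKernel {Γ : Type*} [Fintype Γ] (D Ddot : Matrix Γ Γ ℂ) (G₁ G₂ : (m : ℕ) → (Fin m → Γ) → ℂ)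
    (m m₁ m₂ i : ℕ) (X : Fin m → Γ) : ℂ :=
  if h : i ≤ m₁ ∧ i ≤ m₂ ∧ m₁ + m₂ = m + 2 * i then
    ∑ V : Fin i → Γ, ∑ W : Fin i → Γ,
      detDeriv (covMatrix D V W) (covMatrix Ddot V W) *
        G₁ m₁ (fun j : Fin m₁ =>
          if hj : j.val < m₁ - i then X ⟨j.val, by omega⟩ else V ⟨j.val - (m₁ - i), by omega⟩) *
        G₂ m₂ (fun j : Fin m₂ =>
          if hj : j.val < i then W ⟨(i - 1) - j.val, by omega⟩ else X ⟨(m₁ - i) + (j.val - i), by omega⟩)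
  else 0

/-- **The right side of Proposition 2**, `Q_{m,r}(X) = ∫dκ_{mr} Σ_{V,W} σ(i) (∂_t det 𝒟_t^{(i)}(V,W)) G_{m₁r₁}(X₁,V)
G_{m₂r₂}(W̃,X₂)` with `∫dκ_{mr} = Σ_{r₁+r₂=r, r₁,r₂≥1} Σ_{(m₁,m₂,i) ∈ 𝓜_{r₁r₂m}} κ_{m₁m₂i}` (F7b `kappaSum`, `MIndex`,
`kappa`; `m̄(r)` the degree of `𝒢_r`), for a family of coefficient functions `G r m` and a sign `σ(i) ∈ {±1}` per
`i`-term (print: `σ ≡ -1` in Proposition 2, `σ ≡ +1` in (4.3); module docstring "SIGN"). `Sal98.P2` · Salmhofer 1998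
Proposition 2 · p.12 L69–106. [cite: Salmhofer1998, Proposition 2 (p.12 L69–106)] -/
def wickReorderKernel {Γ : Type*} [Fintype Γ] (σ : ℕ → ℤ) (mbar : ℕ → ℕ) (D Ddot : Matrix Γ Γ ℂ)
    (G : ℕ → (m : ℕ) → (Fin m → Γ) → ℂ) (m r : ℕ) (X : Fin m → Γ) : ℂ :=
  kappaSum mbar m r fun r₁ m₁ r₂ m₂ i => (σ i : ℂ) * pairKernel D Ddot (G r₁) (G r₂) m m₁ m₂ i X

/-- The cell's determination of the sign of the `i`-term in the tree's conventions, `σ(i) = (-1)^{i-1}` (module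
docstring "SIGN"; print: Proposition 2 displays `σ ≡ -1`, (4.3) displays `σ ≡ +1`).  A definition only — it is NOT
asserted by `WickReorderingFormula`. [cite: Salmhofer1998, Proposition 2 (p.12 L72–76) and (4.3) (p.14 L44–52)] -/
def wickReorderSign (i : ℕ) : ℤ := (-1) ^ (i - 1)

/-- **Proposition 2 (p.12 L69–106) with (3.16)–(3.17) (p.12 L47–63)**, as a named fact (D-0014, wave-optional
licence F-078), with the sign of each `i`-term existential (module docstring "SIGN").  There are signs `σ(i) ∈ {+1,-1}`
such that: for `Γ` finite, `D` and `Ḋ` antisymmetric matrices on `Γ` (print: `D_t = C - C_t` and `Ḋ_t = ∂_tD_t = -Ċ_t`,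
antisymmetric by Lemma 2 / (5.2)), `(𝒢_r)_{r ≥ 1}` elements of the even subalgebra ("`V(ψ)` an element of the even
subalgebra … the same holds for `𝒢^eff(t,ψ)`", p.11 L134–137, L143) whose Wick-ordered coefficient functions
`G_{m,r} = wickKernel ℂ D 𝒢_r m` ((3.12), F7af) vanish for `m > m̄(r)`, and every `r`, the order-`r` bilinear term
`𝒬_r = Σ_{r₁+r₂=r, r₁,r₂ ≥ 1} (δ𝒢_{r₁}/δψ, Ċ δ𝒢_{r₂}/δψ)_Γ` ((3.16), with the pairing of (RGE)/Proposition 1 at `Ċ = -Ḋ`;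
F7x `grassmannDerivPairing`) has the Wick-ordered representation (3.17)
`𝒬_r = Σ_m Σ_{X ∈ Γ^m} Q_{m,r}(X) Ω_D(ψ(X_1)⋯ψ(X_m))` with
`Q_{m,r}(X) = ∫dκ_{mr} Σ_{V,W} σ(i) ∂_t det𝒟_t^{(i)}(V,W) G_{m₁r₁}(X₁,V) G_{m₂r₂}(W̃,X₂)` (`wickReorderKernel σ`) — in
particular `Q_{m,1} = 0` (empty `r₁ + r₂ = 1`).  Print displays `σ ≡ -1` (Proposition 2) resp. `σ ≡ +1` ((4.3)); the
cell's determination is `σ(i) = (-1)^{i-1}` (`wickReorderSign`, not asserted).  (Comparison of coefficients then gives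
(3.20), `wickKernel D 𝒬_r m = 𝔸_m Q_{m,r}`.)  `Sal98.P2` · Salmhofer 1998 Proposition 2 · p.12 L47–106.
[cite: Salmhofer1998, Proposition 2 (p.12 L69–106); (3.16)–(3.17) (p.12 L47–63); (4.3) (p.14 L44–52); Appendix B (p.30 L1 – p.31 L140)] -/
def WickReorderingFormula : Prop :=
  ∃ σ : ℕ → ℤ, (∀ i, σ i = 1 ∨ σ i = -1) ∧
    ∀ (Γ : Type) [Fintype Γ] [DecidableEq Γ] (D Ddot : Matrix Γ Γ ℂ),
      D.transpose = -D → Ddot.transpose = -Ddot →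
      ∀ (mbar : ℕ → ℕ) (𝒢 : ℕ → GrassmannAlgebra ℂ Γ),
        (∀ r, 𝒢 r ∈ evenOdd ℂ 0) →
        (∀ (r m : ℕ) (X : Fin m → Γ), mbar r < m → wickKernel ℂ D (𝒢 r) m X = 0) →
        ∀ r : ℕ,
          ∑ r₁ ∈ Finset.Icc 1 (r - 1), grassmannDerivPairing ℂ (-Ddot) (𝒢 r₁) (𝒢 (r - r₁)) =
            ∑ m ∈ Finset.range (Fintype.card Γ + 1), ∑ X : Fin m → Γ,
              wickReorderKernel σ mbar D Ddot (fun r' m' => wickKernel ℂ D (𝒢 r') m') m r X •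
                wickOrder ℂ D (genProd ℂ X)

/-! ### Proved: the directional derivative at `i = 1`, and the smallest instance fixing the orientation -/

/-- For a `1 × 1` matrix the directional derivative of `det` is the entry of the direction:
`∂_t det 𝒟_t^{(1)}(V,W) = Ḋ_t(V_1,W_1)`. [cite: Salmhofer1998, §4.1 (4.2) (p.14 L17–27)] -/
theorem detDeriv_one (A B : Matrix (Fin 1) (Fin 1) ℂ) : detDeriv A B = B 0 0 := by
  simp [detDeriv, Matrix.updateCol_self]

/-- `∂_X Ω_D(ψ(A)ψ(B)) = δ_{XA} ψ(B) - δ_{XB} ψ(A)`: the derivative of a Wick-ordered pair (the Wick constant is killed).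
[cite: Salmhofer1998, Appendix B (p.30 L19–24)] -/
theorem grassmannDeriv_wickOrder_pair {Γ : Type*} [Fintype Γ] [DecidableEq Γ] (D : Matrix Γ Γ ℂ) (X A B : Γ) :
    grassmannDeriv ℂ X (wickOrder ℂ D (gen ℂ A * gen ℂ B)) =
      (if X = A then gen ℂ B else 0) - (if X = B then gen ℂ A else 0) := by
  rw [wickOrder_gen_mul_gen, map_add, grassmannDeriv_algebraMap, add_zero, grassmannDeriv_gen_mul, grassmannDeriv_gen]
  by_cases hA : X = A <;> by_cases hB : X = B <;> simp [hA, hB]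

/-- **The smallest instance, fixing `σ(1)`** (module docstring "SIGN"): for `𝒢¹ = Ω_D(ψ(A)ψ(B))`,
`𝒢² = Ω_D(ψ(E)ψ(F))` and any pairing matrix `C'`,
`(δ𝒢¹/δψ, C' δ𝒢²/δψ)_Γ = C'(A,E) ψ_Bψ_F - C'(A,F) ψ_Bψ_E - C'(B,E) ψ_Aψ_F + C'(B,F) ψ_Aψ_E`.
With `C' = Ċ = -Ḋ`, `G¹(A,B) = -G¹(B,A) = ½`, `G²(E,F) = -G²(F,E) = ½` ((3.12): `wickKernel_wickOrder_genProd`) the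
degree-two coefficients are `+κ_{221} Σ_{V,W} Ḋ(V,W) G¹(U,V) G²(W,U')` (`κ_{221} = 4`): `σ(1) = +1`, the orientation
of (4.3) and not of the display of Proposition 2 (module docstring "SIGN").
[cite: Salmhofer1998, Proposition 2 (p.12 L69–106) and (4.3) (p.14 L44–52)] -/
theorem grassmannDerivPairing_wickPair {Γ : Type*} [Fintype Γ] [DecidableEq Γ] (D C' : Matrix Γ Γ ℂ)
    (A B E F : Γ) :
    grassmannDerivPairing ℂ C' (wickOrder ℂ D (gen ℂ A * gen ℂ B)) (wickOrder ℂ D (gen ℂ E * gen ℂ F)) =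
      C' A E • (gen ℂ B * gen ℂ F) - C' A F • (gen ℂ B * gen ℂ E) - C' B E • (gen ℂ A * gen ℂ F) +
        C' B F • (gen ℂ A * gen ℂ E) := by
  -- collapse a double sum over `Γ × Γ` on two Kronecker deltas
  have key : ∀ (u v : GrassmannAlgebra ℂ Γ) (P Q : Γ),
      ∑ X, ∑ Y, C' X Y • ((if X = P then u else 0) * (if Y = Q then v else 0)) = C' P Q • (u * v) := by
    intro u v P Q
    have h : ∀ X Y : Γ, C' X Y • ((if X = P then u else 0) * (if Y = Q then v else 0)) =
        if X = P then (if Y = Q then C' X Y • (u * v) else 0) else 0 := by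
      intro X Y
      by_cases hX : X = P
      · by_cases hY : Y = Q
        · simp [hX, hY]
        · simp [hX, hY]
      · simp [hX]
    simp only [h]
    rw [Finset.sum_comm]
    simp only [Finset.sum_ite_eq', Finset.mem_univ, if_true]
  simp only [grassmannDerivPairing_apply, grassmannDeriv_wickOrder_pair, mul_sub, sub_mul, smul_sub,
    Finset.sum_sub_distrib, key]
  abel

end Salmhofer1998

end Literature.MathematicalPhysics.QuantumLattice.FermiRG
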